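import Summits.BirchSwinnertonDyer.BirchSwinnertonDyer.Theorems.GenusKolyvaginAtTwoGenusPrimitiveSupplyAtTwoTwistingPrimeEntangledCriterion
import HarnessLib

/-!
# Route `GenusKolyvaginAtTwo`, crux K₄⁻ `K4Neg` (stmt-BirchSwinnertonDyer-31526), LINES 37/38 —
# THE LEVEL-`4` FIELD OF THE TWIN: a class dies on `Γ_{ℚ(E[4])}` iff it dies on `Γ_{ℚ(E^{(d)}[4])}`

Width seat `bsd-line-gk2-p4` g35 (cell `bsd-f1-sign2`), WIDTH-5 attach on route `GenusKolyvaginAtTwo` rev 59; first of two files (sequel: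
`…K4NegPhantomTwinIffLocTrivial`, which proves LINE 37's typed proposal `PhantomTwinIffLocTrivial_T` and the `𝒩/𝒫` dictionary).
`--supports stmt-BirchSwinnertonDyer-31526 --as helper`.  THEOREMS ONLY (no definition, no named fact, no `sorry`); standard axioms.
**BSD is NOT proved by this file; `K4Neg` is NOT proved; no item is closed by it.**

WHY.  LINE 37 «frobenius_split» (pen bsd-idea-1 g28) reads the twin's bit `𝒩(Wd)` := «no non-zero class of `Sel₂(Wd)` dies on
`Γ_{ℚ(Wd[4])}`» in the TWIN'S OWN level-`4` tower, while every kernel theorem of the cell (Lawson–Wuthrich class `ξ_W`, the entanglement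
criterion §48, the trace bit) is phrased with `Γ_{ℚ(E[4])}`, `E = W`.  The two fields `ℚ(E[4]) ≠ ℚ(Wd[4])` differ (`Wd[4] ≅ E[4] ⊗ χ_d`), but:

* §1 `forall_h1Eval_eq_zero_of_forall_inf` — INDEX-TWO DESCENT for the zeros of `ρ ↦ [x, ρ]`: `S ⊴ Γ_K` fixing `E[n]`, `H ⊴ Γ_K` of index
  `≤ 2`, `E[n]` without non-zero `Γ_K`-fixed point: if `[x, ·]` vanishes on `S ∩ H` it vanishes on `S` (the common value on `S ∖ H` is
  `Γ_K`-fixed, by `[x, σρσ⁻¹] = σ[x, ρ]`).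
* §2 `mem_torsionFixing_twist_iff_of_smul_geomSqrt_eq` — **`Γ_{K(Wd[n])} ∩ Γ_{K(√d)} = Γ_{K(E[n])} ∩ Γ_{K(√d)}`** for ANY model `Wd` of `W^{(d)}`
  over any field of characteristic `≠ 2` (signed isomorphism `Wd(K̄) ≃ W(K̄)`, *AEC* X.5.4); the stabiliser of `√d` (normal: tree `stabilizer_geomSqrt_normal`) has index `≤ 2`.
* §3 ★ `forall_torsionFixing_four_twist_h1Eval_eq_zero_iff` / `forall_torsionFixing_four_h1Eval_eq_zero_iff_twist` — for `W/ℚ` with `ρ̄_{W,2}`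
  onto (so `E[2]^{Γ_ℚ} = 0`, Dokchitser–Dokchitser) and any class of `H¹(ℚ, Wd[2])`, resp. `H¹(ℚ, E[2])`: **it dies on `Γ_{ℚ(E[4])}` IFF it dies
  on `Γ_{ℚ(Wd[4])}`**.  Group-theoretically: `H¹(GL₂(ℤ/4), 𝔽₂²) = ℤ/2` lives on the quotient `1 + 2V` (`V = ⟨transpositions⟩`) of
  `Gal(ℚ(E[4])/ℚ(E[2])) = 1 + 2M₂(𝔽₂)`, and twisting moves that group only by the central `−1 = 1 + 2·𝟙 ∈ 1 + 2𝔽₂[ω]`.  CONSEQUENCES: the twin's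
  bit `𝒩(Wd)` may be read in either tower; the Lawson–Wuthrich class of `W` dies on the level-`4` field of EVERY twist (it IS the LW class of
  the twist under `H¹(ℚ, E[2]) = H¹(ℚ, Wd[2])`).

References: [LawsonWuthrich2016] §3 (Lemma 6, p = 2); [MazurRubin2010] Remark 2.4; [SilvermanAEC2009] X.5 Cor. 5.4, III.§7, VIII.§1;
[GrossLMS1991] §9 (pairing after Prop. 9.1); [DokchitserDokchitserMathZ2012] Thm. (1).
-/

set_option linter.dupNamespace false -- `Summit.<P>.<Sub>` repeats `BirchSwinnertonDyer` (D-0017)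
set_option autoImplicit false

noncomputable section

open scoped Classical Pointwise

namespace Summit.BirchSwinnertonDyer.BirchSwinnertonDyer.Theorems.GenusExact.PhantomDescentBit.TwinLevelFour

open WeierstrassCurve Field NumberField IsDedekindDomain
open Literature.NumberTheory.GaloisRepresentations Literature.NumberTheory.EllipticCurves
open Literature.NumberTheory
open Summit.BirchSwinnertonDyer.BirchSwinnertonDyer.Theorems.GenusKolyTwistingPrime

universe u

/-! ## §1 Index-two descent for the zeros of `ρ ↦ [x, ρ]` -/

section IndexTwo

variable {K : Type u} [Field K] (X : WeierstrassCurve K) (n : ℤ)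

/-- **INDEX-TWO DESCENT.**  `S ⊴ Γ_K` a normal subgroup acting trivially on `E[n]`, `H ⊴ Γ_K` a normal subgroup of index `≤ 2`
(`g₁, g₂ ∉ H ⟹ g₁g₂ ∈ H`), `E[n]` without non-zero `Γ_K`-fixed points, `x ∈ H¹(K, E[n])`.  If `[x, h] = 0` for every
`h ∈ S ∩ H`, then `[x, h] = 0` for every `h ∈ S`.  Proof: `ρ ↦ [x, ρ]` is a homomorphism on `S` (`h1Eval_mul`), so all elements of
`S ∖ H` share ONE value `t₀` (`h·h' ∈ S ∩ H`); by `Γ_K`-equivariance `[x, σhσ⁻¹] = σ[x, h]` (`h1Eval_conj`) and normality of `S`, `H`,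
`t₀` is `Γ_K`-fixed, hence `0`. [cite: GrossLMS1991, §9 (pairing after Prop. 9.1)] [cite: SilvermanAEC2009, VIII.§1] -/
theorem forall_h1Eval_eq_zero_of_forall_inf (S H : Subgroup (absoluteGaloisGroup K)) [hSn : S.Normal] [hHn : H.Normal]
    (hS : S ≤ torsionFixing X n)
    (hH : ∀ g₁ g₂ : absoluteGaloisGroup K, g₁ ∉ H → g₂ ∉ H → g₁ * g₂ ∈ H)
    (hfix : ∀ T : geomTorsion X n, (∀ g : absoluteGaloisGroup K, g • T = T) → T = 0)
    (x : galH1Torsion X n) (hx : ∀ h ∈ S, h ∈ H → h1Eval X n x h = 0) :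
    ∀ h ∈ S, h1Eval X n x h = 0 := by
  intro h hh
  by_cases hhH : h ∈ H
  · exact hx h hh hhH
  -- every element of `S ∖ H` has the value `[x, h]`
  have hval : ∀ h' ∈ S, h' ∉ H → h1Eval X n x h' = h1Eval X n x h := by
    intro h' hh' hh'H
    have h0 : h1Eval X n x (h * h') = 0 := hx (h * h') (S.mul_mem hh hh') (hH h h' hhH hh'H)
    have hself : h1Eval X n x (h * h) = 0 := hx (h * h) (S.mul_mem hh hh) (hH h h hhH hhH)
    rw [h1Eval_mul X n x (hS hh)] at h0 hself
    rw [eq_neg_of_add_eq_zero_right h0, ← eq_neg_of_add_eq_zero_right hself]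
  -- that value is `Γ_K`-fixed
  have hfixed : ∀ g : absoluteGaloisGroup K, g • h1Eval X n x h = h1Eval X n x h := by
    intro g
    rw [← h1Eval_conj X n x g (hS hh)]
    refine hval _ (hSn.conj_mem h hh g) fun hmem ↦ hhH ?_
    have e : g⁻¹ * (g * h * g⁻¹) * g⁻¹⁻¹ = h := by group
    rw [← e]
    exact hHn.conj_mem _ hmem g⁻¹
  exact hfix _ hfixed

/-- The same with the roles packaged as an `iff` between two trivialising subgroups `S₁, S₂ ⊴ Γ_K` of `E[n]` that AGREE on `H`:
`[x, ·]` vanishes on `S₁` iff it vanishes on `S₂`. [cite: GrossLMS1991, §9 (pairing after Prop. 9.1)] -/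
theorem forall_h1Eval_eq_zero_iff_of_inf_agree (S₁ S₂ H : Subgroup (absoluteGaloisGroup K)) [S₁.Normal] [S₂.Normal] [H.Normal]
    (hS₁ : S₁ ≤ torsionFixing X n) (hS₂ : S₂ ≤ torsionFixing X n)
    (hH : ∀ g₁ g₂ : absoluteGaloisGroup K, g₁ ∉ H → g₂ ∉ H → g₁ * g₂ ∈ H)
    (hagree : ∀ g ∈ H, g ∈ S₁ ↔ g ∈ S₂)
    (hfix : ∀ T : geomTorsion X n, (∀ g : absoluteGaloisGroup K, g • T = T) → T = 0)
    (x : galH1Torsion X n) :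
    (∀ h ∈ S₁, h1Eval X n x h = 0) ↔ ∀ h ∈ S₂, h1Eval X n x h = 0 :=
  ⟨fun h₁ ↦ forall_h1Eval_eq_zero_of_forall_inf X n S₂ H hS₂ hH hfix x
      fun h hh hhH ↦ h₁ h ((hagree h hhH).mpr hh),
    fun h₂ ↦ forall_h1Eval_eq_zero_of_forall_inf X n S₁ H hS₁ hH hfix x
      fun h hh hhH ↦ h₂ h ((hagree h hhH).mp hh)⟩

end IndexTwo

/-! ## §2 The stabiliser of `√d`, and the torsion fields of a twist seen from `Γ_{K(√d)}` -/

section SqrtStabilizer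

variable {K : Type u} [Field K]

/-- `σ√d = −√d` when `σ√d ≠ √d` (the two roots of `X² − d`). [folklore] [cite: SilvermanAEC2009, X.5 Cor. 5.4] -/
theorem smul_geomSqrt_eq_neg_of_ne {d : K} {σ : absoluteGaloisGroup K} (hσ : σ • geomSqrt d ≠ geomSqrt d) :
    σ • geomSqrt d = -geomSqrt d := by
  rcases map_geomSqrt (absoluteGaloisGroup.toAlgEquiv K σ) d with h | h
  · exact absurd h hσ
  · exact h

/-- **The stabiliser of `√d` has index `≤ 2`**: two elements moving `√d` have a product fixing it. [folklore]
[cite: SilvermanAEC2009, X.5 Cor. 5.4] -/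
theorem mul_mem_stabilizer_geomSqrt {d : K} {g₁ g₂ : absoluteGaloisGroup K}
    (h₁ : g₁ ∉ MulAction.stabilizer (absoluteGaloisGroup K) (geomSqrt d))
    (h₂ : g₂ ∉ MulAction.stabilizer (absoluteGaloisGroup K) (geomSqrt d)) :
    g₁ * g₂ ∈ MulAction.stabilizer (absoluteGaloisGroup K) (geomSqrt d) := by
  rw [MulAction.mem_stabilizer_iff] at h₁ h₂ ⊢
  rw [mul_smul, smul_geomSqrt_eq_neg_of_ne h₂, smul_neg, smul_geomSqrt_eq_neg_of_ne h₁, neg_neg]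

variable [NeZero (2 : K)] (V : WeierstrassCurve K)

/-- **Signed isomorphism `Wd(K̄) ≃+ W(K̄)` for ANY model `C • W^{(d)} = Wd` of the twist**, with the sign read on `√d`:
`e(σP) = σ e(P)` if `σ√d = √d`, `e(σP) = −σ e(P)` if `σ√d = −√d` (*AEC* X.5 Cor. 5.4 composed with the change of variables).
[cite: SilvermanAEC2009, X.5 Cor. 5.4 and X.2 Prop. 2.4] -/
theorem exists_addEquiv_geomPoints_sign_of_twist {d : K} (hd : d ≠ 0) {Vd : WeierstrassCurve K} {C : VariableChange K}
    (hVd : C • V.quadraticTwist d = Vd) :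
    ∃ e : geomPoints Vd ≃+ geomPoints V,
      (∀ σ : absoluteGaloisGroup K, σ • geomSqrt d = geomSqrt d → ∀ P, e (σ • P) = σ • e P) ∧
      (∀ σ : absoluteGaloisGroup K, σ • geomSqrt d = -geomSqrt d → ∀ P, e (σ • P) = -(σ • e P)) := by
  obtain ⟨f, hfpos, hfneg⟩ := V.exists_addEquiv_geomPoints_quadraticTwist_sign hd
  have htw : ∀ (σ : absoluteGaloisGroup K) (Q : geomPoints Vd),
      (twistPointsIso hVd).symm (σ • Q) = σ • (twistPointsIso hVd).symm Q := fun σ Q ↦ by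
    apply (twistPointsIso hVd).injective
    rw [AddEquiv.apply_symm_apply, twistPointsIso_smul, AddEquiv.apply_symm_apply]
  refine ⟨(twistPointsIso hVd).symm.trans f, fun σ hσ P ↦ ?_, fun σ hσ P ↦ ?_⟩
  · rw [AddEquiv.trans_apply, AddEquiv.trans_apply, htw, hfpos σ hσ]
  · rw [AddEquiv.trans_apply, AddEquiv.trans_apply, htw, hfneg σ hσ]

omit [NeZero (2 : K)] in
/-- **Transport of pointwise fixing along an isomorphism commuting with ONE `σ`**: if `e : Vd(K̄) ≃+ V(K̄)` satisfies
`e(σP) = σ e(P)` for all `P`, then `σ` fixes `V[n]` pointwise as soon as it fixes `Vd[n]` pointwise. [folklore]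
[cite: SilvermanAEC2009, X.5 Cor. 5.4] -/
theorem mem_torsionFixing_of_addEquiv_of_smul_comm {Vd : WeierstrassCurve K} (e : geomPoints Vd ≃+ geomPoints V)
    {σ : absoluteGaloisGroup K} (he : ∀ P, e (σ • P) = σ • e P) (n : ℤ) (hσ : σ ∈ torsionFixing Vd n) :
    σ ∈ torsionFixing V n := by
  refine (mem_torsionFixing_iff V n).mpr fun T ↦ Subtype.ext ?_
  have hQ : e.symm (T : geomPoints V) ∈ geomTorsion Vd n := by
    rw [mem_geomTorsion_iff, ← map_zsmul, (mem_geomTorsion_iff V n _).mp T.2, map_zero]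
  have hfixQ := congrArg Subtype.val ((mem_torsionFixing_iff Vd n).mp hσ ⟨_, hQ⟩)
  rw [Literature.NumberTheory.EllipticCurves.AddSubgroup.torsionBy.coe_smul] at hfixQ ⊢
  change σ • e.symm (T : geomPoints V) = e.symm (T : geomPoints V) at hfixQ
  have h := congrArg e hfixQ
  rw [he, AddEquiv.apply_symm_apply] at h
  exact h

/-- **`Γ_{K(Wd[n])} ∩ Γ_{K(√d)} = Γ_{K(E[n])} ∩ Γ_{K(√d)}`**: for `σ` fixing `√d`, `σ` fixes `Wd[n]` pointwise iff it fixes `W[n]`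
pointwise (`Wd ≅ W` over `K(√d)`, `Γ_{K(√d)}`-equivariantly). [cite: SilvermanAEC2009, X.5 Cor. 5.4] [cite: MazurRubin2010, Remark 2.4] -/
theorem mem_torsionFixing_twist_iff_of_smul_geomSqrt_eq {d : K} (hd : d ≠ 0) {Vd : WeierstrassCurve K} {C : VariableChange K}
    (hVd : C • V.quadraticTwist d = Vd) (n : ℤ) {σ : absoluteGaloisGroup K} (hσ : σ • geomSqrt d = geomSqrt d) :
    σ ∈ torsionFixing Vd n ↔ σ ∈ torsionFixing V n := by
  obtain ⟨e, hepos, -⟩ := exists_addEquiv_geomPoints_sign_of_twist V hd hVd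
  refine ⟨mem_torsionFixing_of_addEquiv_of_smul_comm V e (hepos σ hσ) n, fun h ↦ ?_⟩
  refine mem_torsionFixing_of_addEquiv_of_smul_comm Vd e.symm (fun P ↦ ?_) n h
  apply e.injective
  rw [e.apply_symm_apply, hepos σ hσ, e.apply_symm_apply]

end SqrtStabilizer

/-! ## §3 The level-`4` field of the twin: dying on `Γ_{ℚ(E[4])}` ⟺ dying on `Γ_{ℚ(Wd[4])}` -/

section LevelFourTwin

variable (W : WeierstrassCurve ℚ) [W.IsElliptic]

/-- **`E[2]` has no non-zero `Γ_ℚ`-fixed point when `ρ̄_{E,2}` is onto** (some automorphism of `E[2]` moves a non-zero point, and every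
automorphism is a `ρ̄_{E,2}(σ)`; Dokchitser–Dokchitser (1)). [cite: DokchitserDokchitserMathZ2012, Theorem (1)] [cite: SilvermanAEC2009, III.§7] -/
theorem geomTorsion_two_eq_zero_of_forall_smul_eq (hsurj : W.HasSurjectiveModNGaloisRep 2)
    (T : geomTorsion W (2 : ℤ)) (hT : ∀ g : absoluteGaloisGroup ℚ, g • T = T) : T = 0 := by
  by_contra hT0
  obtain ⟨φ, hφ⟩ := DokchitserDokchitser2012.exists_addEquiv_apply_ne W two_ne_zero hT0
  obtain ⟨σ, hσ⟩ := hsurj (Multiplicative.ofAdd φ)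
  apply hφ
  have h := galoisRepTorsion_apply W 2 σ T
  rw [hσ, toAdd_ofAdd, hT] at h
  exact h

/-- The same for ANY model `Wd` of a quadratic twist `W^{(d)}` (transport along the `Γ_ℚ`-equivariant `Wd[2] ≅ W[2]`,
`exists_equivariant_addEquiv_geomTorsion_two_of_twist`). [cite: DokchitserDokchitserMathZ2012, Theorem (1)] [cite: MazurRubin2010, Remark 2.4] -/
theorem geomTorsion_two_twist_eq_zero_of_forall_smul_eq (hsurj : W.HasSurjectiveModNGaloisRep 2)
    {d : ℚ} (hd : d ≠ 0) {Wd : WeierstrassCurve ℚ} [Wd.IsElliptic] {C : VariableChange ℚ} (hWd : C • W.quadraticTwist d = Wd)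
    (T : geomTorsion Wd (2 : ℤ)) (hT : ∀ g : absoluteGaloisGroup ℚ, g • T = T) : T = 0 := by
  obtain ⟨ψ₂, hψ₂⟩ := exists_equivariant_addEquiv_geomTorsion_two_of_twist W hd hWd
  have h := geomTorsion_two_eq_zero_of_forall_smul_eq W hsurj (ψ₂ T) fun g ↦ by rw [← hψ₂, hT g]
  apply ψ₂.injective
  rw [h, map_zero]

omit [W.IsElliptic] in
/-- `Γ_{ℚ(Wd[2])} = Γ_{ℚ(E[2])}` (both inclusions) for any model of a quadratic twist. [cite: MazurRubin2010, Remark 2.4] -/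
theorem torsionFixing_two_twist_le_and_ge {d : ℚ} (hd : d ≠ 0) {Wd : WeierstrassCurve ℚ} [Wd.IsElliptic] {C : VariableChange ℚ}
    (hWd : C • W.quadraticTwist d = Wd) :
    torsionFixing W (2 : ℤ) ≤ torsionFixing Wd (2 : ℤ) ∧ torsionFixing Wd (2 : ℤ) ≤ torsionFixing W (2 : ℤ) := by
  obtain ⟨ψ₂, hψ₂⟩ := exists_equivariant_addEquiv_geomTorsion_two_of_twist W hd hWd
  refine ⟨torsionFixing_le_of_equivariant_addEquiv Wd W (2 : ℤ) ψ₂ hψ₂,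
    torsionFixing_le_of_equivariant_addEquiv W Wd (2 : ℤ) ψ₂.symm fun g t ↦ ?_⟩
  apply ψ₂.injective
  rw [ψ₂.apply_symm_apply, hψ₂, ψ₂.apply_symm_apply]

/-- ★ **THE LEVEL-`4` FIELD OF THE TWIN (classes of the twist).**  `W/ℚ` elliptic with `ρ̄_{W,2}` onto, `Wd` any elliptic model of a
quadratic twist `W^{(d)}` (`d ≠ 0`), `c ∈ H¹(ℚ, Wd[2])`.  Then **`[c, ·]` vanishes on `Γ_{ℚ(E[4])}` (`E = W`) iff it vanishes on
`Γ_{ℚ(Wd[4])}`** — although the two level-`4` fields differ.  Proof: both groups fix `Wd[2] = W[2]` pointwise and agree on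
`Γ_{ℚ(√d)}` (§2), a normal subgroup of index `≤ 2`, and `E[2]` has no `Γ_ℚ`-fixed point; index-two descent (§1) in both directions.
(Group-theoretically: `H¹(GL₂(ℤ/4), 𝔽₂²) = ℤ/2` is carried by the quotient `1 + 2·V`, `V = ⟨transpositions⟩`, and the twist changes
`Gal(ℚ(E[4])/ℚ(E[2]))` only by the central `1 + 2·𝟙 ∈ 1 + 2·𝔽₂[ω]`.) [cite: LawsonWuthrich2016, §3 (Lemma 6, p = 2)]
[cite: MazurRubin2010, Remark 2.4] [cite: SilvermanAEC2009, X.5 Cor. 5.4] -/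
theorem forall_torsionFixing_four_twist_h1Eval_eq_zero_iff (hsurj : W.HasSurjectiveModNGaloisRep 2)
    {d : ℚ} (hd : d ≠ 0) {Wd : WeierstrassCurve ℚ} [Wd.IsElliptic] {C : VariableChange ℚ} (hWd : C • W.quadraticTwist d = Wd)
    (c : galH1Torsion Wd (2 : ℤ)) :
    (∀ h ∈ torsionFixing W (4 : ℤ), h1Eval Wd (2 : ℤ) c h = 0) ↔
      ∀ h ∈ torsionFixing Wd (4 : ℤ), h1Eval Wd (2 : ℤ) c h = 0 := by
  have hTd := (torsionFixing_two_twist_le_and_ge W hd hWd).1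
  have hS₁ : torsionFixing W (4 : ℤ) ≤ torsionFixing Wd (2 : ℤ) :=
    (KolyvaginLowerBoundAtTwo.torsionFixing_le_of_dvd W (show (2 : ℤ) ∣ 4 by norm_num)).trans hTd
  have hS₂ : torsionFixing Wd (4 : ℤ) ≤ torsionFixing Wd (2 : ℤ) :=
    KolyvaginLowerBoundAtTwo.torsionFixing_le_of_dvd Wd (show (2 : ℤ) ∣ 4 by norm_num)
  haveI := stabilizer_geomSqrt_normal (K := ℚ) d
  exact forall_h1Eval_eq_zero_iff_of_inf_agree Wd (2 : ℤ) (torsionFixing W (4 : ℤ)) (torsionFixing Wd (4 : ℤ))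
    (MulAction.stabilizer (absoluteGaloisGroup ℚ) (geomSqrt d)) hS₁ hS₂ (fun _ _ h₁ h₂ ↦ mul_mem_stabilizer_geomSqrt h₁ h₂)
    (fun g hg ↦ (mem_torsionFixing_twist_iff_of_smul_geomSqrt_eq W hd hWd 4 (MulAction.mem_stabilizer_iff.mp hg)).symm)
    (geomTorsion_two_twist_eq_zero_of_forall_smul_eq W hsurj hd hWd) c

/-- ★ **THE LEVEL-`4` FIELD OF THE TWIN (classes of the curve).**  Same frame, `x ∈ H¹(ℚ, E[2])`: **`[x, ·]` vanishes on `Γ_{ℚ(E[4])}`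
iff it vanishes on `Γ_{ℚ(Wd[4])}`** — in particular the Lawson–Wuthrich class of `W` dies on the level-`4` field of EVERY twist.
[cite: LawsonWuthrich2016, §3 (Lemma 6, p = 2)] [cite: MazurRubin2010, Remark 2.4] -/
theorem forall_torsionFixing_four_h1Eval_eq_zero_iff_twist (hsurj : W.HasSurjectiveModNGaloisRep 2)
    {d : ℚ} (hd : d ≠ 0) {Wd : WeierstrassCurve ℚ} [Wd.IsElliptic] {C : VariableChange ℚ} (hWd : C • W.quadraticTwist d = Wd)
    (x : galH1Torsion W (2 : ℤ)) :
    (∀ h ∈ torsionFixing W (4 : ℤ), h1Eval W (2 : ℤ) x h = 0) ↔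
      ∀ h ∈ torsionFixing Wd (4 : ℤ), h1Eval W (2 : ℤ) x h = 0 := by
  have hdT := (torsionFixing_two_twist_le_and_ge W hd hWd).2
  have hS₁ : torsionFixing W (4 : ℤ) ≤ torsionFixing W (2 : ℤ) :=
    KolyvaginLowerBoundAtTwo.torsionFixing_le_of_dvd W (show (2 : ℤ) ∣ 4 by norm_num)
  have hS₂ : torsionFixing Wd (4 : ℤ) ≤ torsionFixing W (2 : ℤ) :=
    (KolyvaginLowerBoundAtTwo.torsionFixing_le_of_dvd Wd (show (2 : ℤ) ∣ 4 by norm_num)).trans hdT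
  haveI := stabilizer_geomSqrt_normal (K := ℚ) d
  exact forall_h1Eval_eq_zero_iff_of_inf_agree W (2 : ℤ) (torsionFixing W (4 : ℤ)) (torsionFixing Wd (4 : ℤ))
    (MulAction.stabilizer (absoluteGaloisGroup ℚ) (geomSqrt d)) hS₁ hS₂ (fun _ _ h₁ h₂ ↦ mul_mem_stabilizer_geomSqrt h₁ h₂)
    (fun g hg ↦ (mem_torsionFixing_twist_iff_of_smul_geomSqrt_eq W hd hWd 4 (MulAction.mem_stabilizer_iff.mp hg)).symm)
    (geomTorsion_two_eq_zero_of_forall_smul_eq W hsurj) x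

/-- §3 with the classes spelled at level `((2 : ℕ) : ℤ)` (the Selmer-structure currency of §46–§48; level-`4` groups at `(4 : ℤ)`).
[cite: LawsonWuthrich2016, §3 (Lemma 6, p = 2)] [cite: MazurRubin2010, Remark 2.4] -/
theorem forall_torsionFixing_four_twist_h1Eval_eq_zero_iff_natCast (hsurj : W.HasSurjectiveModNGaloisRep 2)
    {d : ℚ} (hd : d ≠ 0) {Wd : WeierstrassCurve ℚ} [Wd.IsElliptic] {C : VariableChange ℚ} (hWd : C • W.quadraticTwist d = Wd)
    (c : galH1Torsion Wd ((2 : ℕ) : ℤ)) :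
    (∀ h ∈ torsionFixing W (4 : ℤ), h1Eval Wd ((2 : ℕ) : ℤ) c h = 0) ↔
      ∀ h ∈ torsionFixing Wd (4 : ℤ), h1Eval Wd ((2 : ℕ) : ℤ) c h = 0 := by
  have e2 : ((2 : ℕ) : ℤ) = (2 : ℤ) := by norm_num
  revert c
  rw [e2]
  exact forall_torsionFixing_four_twist_h1Eval_eq_zero_iff W hsurj hd hWd

end LevelFourTwin

end Summit.BirchSwinnertonDyer.BirchSwinnertonDyer.Theorems.GenusExact.PhantomDescentBit.TwinLevelFour

end
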